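import Summits.BirchSwinnertonDyer.Rank1Residual.Additive.KobayashiHondaPoints
import HarnessLib

/-!
# Honda's isomorphism `i = exp_E ∘ ℓ ∈ Xℤ_p⟦X⟧` for a logarithm `ℓ` of the SAME Honda type `p − aT + T²` as `log_E`
# (`a = a_p(M)`, any supersingular or not, `p` odd), its inverse, and the Honda points `c(y) = P(i(y)) ∈ E₁(K)` with
# `Λ(c(y)) = ℓ(y)` (route `PrintX8VS` / `PrintX8`, support item `InputHondaSystem` = stmt-BirchSwinnertonDyer-20413, named
# fact `Sprung2012.thm22_exists_isHondaSystem`; file 3 of the local series — the general-type twin of the tree's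
# `Rank1Residual/Additive/KobayashiHondaIso` + `KobayashiHondaPoints` (type `T² + p`), whose architecture it follows)

HONEST FRAMING (desk `pub/bsd-wall/bsd-inputs`, seat `bsd-inputs-honda-p1`, D-0154 (2) INPUTS): THEOREMS ONLY — no definition, no
named fact, no instance, no `sorry`; closes nothing by itself; BSD is not proved by any of this.

## Setting and content

`M/ℤ_p` a Weierstrass model with elliptic generic fibre `E = M ⊗ ℚ_p`, `log_E = formalLog`, `exp_E = formalExp`;
`ℓ ∈ Xℚ_p⟦X⟧` ANY power series with `ℓ(0) = 0`, `‖[X¹]ℓ‖ = 1` (later: Sprung's logarithm of file 1). To stay DEFINITION-FREE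
the isomorphism is delivered EXISTENTIALLY as a pair of integral series `i, j ∈ Xℤ_p⟦X⟧` with `i ∘ j = X = j ∘ i` and
`log_E ∘ (i ⊗ ℚ_p) = ℓ` (inside the proof: `ψ = exp_E ∘ ℓ`, `ψ⁻¹ = substInvOfIsUnit ψ`, lifted by the tree's `liftInt`), and the
point-level statements take any such pair `(i, j)` as hypotheses.

* §1 **`exists_integral_hondaIso`** (`p` odd, `M mod p` elliptic, `a := HasseManin.tr (M mod p)`): if `ℓ` is of Honda type
  `p − aT + T²` (`hondaShift p a ℓ ∈ ℤ_p⟦X⟧`), there are `i, j ∈ Xℤ_p⟦X⟧` with `i ∘ j = X = j ∘ i` and `log_E ∘ (i ⊗ ℚ_p) = ℓ` —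
  `log_E` is of that type by the tree's `WeierstrassCurve.norm_coeff_hondaShift_formalLog_le_one` (Honda 1970 Thm. 9 /
  Kobayashi Thm. 8.4, odd `p`), and two logarithms of one type give integral `exp ∘ log`'s (the tree's
  `norm_coeff_le_one_of_subst_eq`, Honda's Thm. 2 / Kobayashi Thm. 8.3 ii)).
* §2 over a complete ultrametric normed `ℚ_p`-algebra `K` (the tree's chart `ptOf`, logarithm `Λ = ptLog`, evaluation `ev₁`,
  `qEval`), for ANY such pair `(i, j)`: **`Λ(P(i(y))) = ℓ(y)`** for `‖y‖ < 1` when `‖[Xⁿ]ℓ‖ ≤ n`; `i(j(t)) = t`; **every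
  `P ∈ E₁(K)` is `P(i(y))`** with `y = j(z(P))`, `‖y‖ ≤ ‖z(P)‖`; hence `Λ(E₁(K)) ⊆ K' + 𝒪_K` whenever `ℓ(𝔪_K) ⊆ K' + 𝒪_K`.

References: [Kobayashi2003] S. Kobayashi, Invent. Math. 152 (2003), Thm. 8.3, Thm. 8.4, Cor. 8.5, §8.4; [Honda1970] T. Honda,
J. Math. Soc. Japan 22 (1970), Thm. 2 (p. 223), Thm. 9 (p. 240); [Sprung2012] F. Sprung, J. Number Theory 132 (2012),
proof of Thm. 2.2 (p. 1487: "`F_ss ≅ Ê` … via Honda theory").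
-/

set_option autoImplicit false
-- the Theorems namespace of this sub repeats the summit name by design (D-0017 nested layout)
set_option linter.dupNamespace false

noncomputable section

open scoped Classical Topology NNReal
open Filter PowerSeries

namespace Summit.BirchSwinnertonDyer.BirchSwinnertonDyer.Theorems

namespace SprungHonda

open Literature.RingTheory.FormalGroups (liftInt map_liftInt hondaShift norm_coeff_le_one_of_subst_eq map_subst_apply)
open Summit.BirchSwinnertonDyer.Rank1Residual.Additive.HondaFss (hasSubst_formalExp')

/-! ## §1 Honda's isomorphism as a pair of integral series -/

section Formal

variable {p : ℕ} [hp : Fact p.Prime] (M : WeierstrassCurve ℤ_[p])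

/-- The formal identities behind `ψ = exp_E ∘ ℓ`: `ψ(0) = 0`, `log_E ∘ ψ = ℓ`, `[X¹]ψ = [X¹]ℓ`. [cite: Kobayashi2003, Thm. 8.3 ii)] -/
theorem formalExp_subst_props {ℓ : ℚ_[p]⟦X⟧} (hℓ0 : constantCoeff ℓ = 0) :
    constantCoeff (PowerSeries.subst ℓ (M.map (PadicInt.Coe.ringHom (p := p))).formalExp) = 0 ∧
    (M.map (PadicInt.Coe.ringHom (p := p))).formalLog.subst
        (PowerSeries.subst ℓ (M.map (PadicInt.Coe.ringHom (p := p))).formalExp) = ℓ ∧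
    coeff 1 (PowerSeries.subst ℓ (M.map (PadicInt.Coe.ringHom (p := p))).formalExp) = coeff 1 ℓ := by
  have hℓs : HasSubst ℓ := HasSubst.of_constantCoeff_zero' hℓ0
  have h0 : constantCoeff (PowerSeries.subst ℓ (M.map (PadicInt.Coe.ringHom (p := p))).formalExp) = 0 := by
    rw [Literature.RingTheory.FormalGroups.constantCoeff_subst_of_constantCoeff_eq_zero hℓ0,
      (M.map PadicInt.Coe.ringHom).constantCoeff_formalExp]
  have hlog : (M.map (PadicInt.Coe.ringHom (p := p))).formalLog.subst
      (PowerSeries.subst ℓ (M.map (PadicInt.Coe.ringHom (p := p))).formalExp) = ℓ := by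
    rw [← PowerSeries.subst_comp_subst_apply (hasSubst_formalExp' p M) hℓs,
      (M.map PadicInt.Coe.ringHom).formalLog_subst_formalExp, PowerSeries.subst_X hℓs]
  refine ⟨h0, hlog, ?_⟩
  have h := congrArg (coeff 1) hlog
  rw [Literature.RingTheory.FormalGroups.coeff_subst_eq_sum h0, Finset.sum_range_succ, Finset.sum_range_succ,
    Finset.sum_range_zero, zero_add, PowerSeries.coeff_zero_eq_constantCoeff,
    (M.map PadicInt.Coe.ringHom).constantCoeff_formalLog, zero_mul, zero_add,
    (M.map PadicInt.Coe.ringHom).coeff_one_formalLog, one_mul, pow_one] at h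
  exact h

variable [hE : (M.map PadicInt.Coe.ringHom).IsElliptic] [hEt : (M.map PadicInt.toZMod).IsElliptic]

/-- **Honda's isomorphism, integrally** (`p` odd): for `ℓ ∈ Xℚ_p⟦X⟧` with `‖[X¹]ℓ‖ = 1` of Honda type `p − aT + T²`,
`a = a_p(M) := HasseManin.tr (M mod p)`, there are `i, j ∈ Xℤ_p⟦X⟧` with `i ∘ j = X = j ∘ i` and `log_E ∘ (i ⊗ ℚ_p) = ℓ`
(`i = exp_E ∘ ℓ`, `j = exp_ℓ ∘ log_E`; `log_E` is of the same type by the tree's Honda congruences, and two logarithms of one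
type give integral transition series — Honda's Thm. 2 via the tree's `norm_coeff_le_one_of_subst_eq`). For `a = 0` these are
the tree's `hondaIso`/`hondaIsoInv`. [cite: Kobayashi2003, Thm. 8.3 ii) and Thm. 8.4] -/
theorem exists_integral_hondaIso (hp2 : p ≠ 2) {ℓ : ℚ_[p]⟦X⟧} (hℓ0 : constantCoeff ℓ = 0) (hℓ1 : ‖coeff 1 ℓ‖ = 1)
    (hℓ : ∀ n, ‖coeff n (hondaShift p
      (Literature.NumberTheory.EllipticCurves.HasseManin.tr (M.map PadicInt.toZMod) : ℚ_[p]) ℓ)‖ ≤ 1) :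
    ∃ i j : ℤ_[p]⟦X⟧, constantCoeff i = 0 ∧ constantCoeff j = 0 ∧ i.subst j = X ∧ j.subst i = X ∧
      (M.map (PadicInt.Coe.ringHom (p := p))).formalLog.subst (i.map PadicInt.Coe.ringHom) = ℓ := by
  obtain ⟨hψ0, hlog, hc1⟩ := formalExp_subst_props M hℓ0
  set ψ : ℚ_[p]⟦X⟧ := PowerSeries.subst ℓ (M.map (PadicInt.Coe.ringHom (p := p))).formalExp with hψdef
  have hu : IsUnit (coeff 1 ψ) := by
    rw [hc1, isUnit_iff_ne_zero, ← norm_pos_iff, hℓ1]; exact one_pos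
  have hψs : HasSubst ψ := HasSubst.of_constantCoeff_zero' hψ0
  set ψ' : ℚ_[p]⟦X⟧ := PowerSeries.substInvOfIsUnit ψ hu with hψ'def
  have hψ'0 : constantCoeff ψ' = 0 := PowerSeries.constantCoeff_substInvOfIsUnit _ _
  have hψ's : HasSubst ψ' := PowerSeries.HasSubst.substInvOfIsUnit _ _
  have hright : ψ.subst ψ' = X := PowerSeries.subst_substInvOfIsUnit_right ψ hψ0 hu
  have hleft : ψ'.subst ψ = X := PowerSeries.subst_substInvOfIsUnit_left ψ hψ0 hu
  -- `ℓ ∘ ψ' = log_E`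
  have hlog' : ℓ.subst ψ' = (M.map (PadicInt.Coe.ringHom (p := p))).formalLog := by
    have h := congrArg (fun F : ℚ_[p]⟦X⟧ ↦ F.subst ψ') hlog
    rw [← h, PowerSeries.subst_comp_subst_apply hψs hψ's, hright, PowerSeries.X_subst]
  -- integrality (Honda)
  have hElog := M.norm_coeff_hondaShift_formalLog_le_one hp2
  have hlog1 : ‖coeff 1 (M.map (PadicInt.Coe.ringHom (p := p))).formalLog‖ = 1 := by
    rw [(M.map PadicInt.Coe.ringHom).coeff_one_formalLog, norm_one]
  have hint : ∀ n, ‖coeff n ψ‖ ≤ 1 :=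
    norm_coeff_le_one_of_subst_eq (p := p) (Padic.norm_int_le_one _) hElog hℓ hlog1 hψ0 hlog
  have hint' : ∀ n, ‖coeff n ψ'‖ ≤ 1 :=
    norm_coeff_le_one_of_subst_eq (p := p) (Padic.norm_int_le_one _) hℓ hElog hℓ1 hψ'0 hlog'
  refine ⟨liftInt ψ hint, liftInt ψ' hint', ?_, ?_, ?_, ?_, ?_⟩
  · have h0 := congrArg (coeff 0) (map_liftInt ψ hint)
    rw [coeff_map, PowerSeries.coeff_zero_eq_constantCoeff, PowerSeries.coeff_zero_eq_constantCoeff, hψ0] at h0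
    exact Subtype.ext h0
  · have h0 := congrArg (coeff 0) (map_liftInt ψ' hint')
    rw [coeff_map, PowerSeries.coeff_zero_eq_constantCoeff, PowerSeries.coeff_zero_eq_constantCoeff, hψ'0] at h0
    exact Subtype.ext h0
  · apply Summit.BirchSwinnertonDyer.Rank1Residual.Additive.HondaFss.map_injective
    have hj0 : constantCoeff (liftInt ψ' hint') = 0 := by
      have h0 := congrArg (coeff 0) (map_liftInt ψ' hint')
      rw [coeff_map, PowerSeries.coeff_zero_eq_constantCoeff, PowerSeries.coeff_zero_eq_constantCoeff, hψ'0] at h0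
      exact Subtype.ext h0
    rw [map_subst_apply (HasSubst.of_constantCoeff_zero' hj0), map_liftInt, map_liftInt, PowerSeries.map_X]
    exact hright
  · apply Summit.BirchSwinnertonDyer.Rank1Residual.Additive.HondaFss.map_injective
    have hi0 : constantCoeff (liftInt ψ hint) = 0 := by
      have h0 := congrArg (coeff 0) (map_liftInt ψ hint)
      rw [coeff_map, PowerSeries.coeff_zero_eq_constantCoeff, PowerSeries.coeff_zero_eq_constantCoeff, hψ0] at h0
      exact Subtype.ext h0
    rw [map_subst_apply (HasSubst.of_constantCoeff_zero' hi0), map_liftInt, map_liftInt, PowerSeries.map_X]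
    exact hleft
  · rw [map_liftInt]; exact hlog

end Formal

/-! ## §2 Honda points `c(y) = P(i(y)) ∈ E₁(K)` over a complete ultrametric normed `ℚ_p`-algebra -/

section Points

open Summit.BirchSwinnertonDyer.Rank1Residual.Additive.BallEval
open Literature.NumberTheory.GaloisRepresentations.LubinTate (unitBall)
open Literature.NumberTheory.EllipticCurves.FormalGroupChart (kernel)

variable {p : ℕ} [hp : Fact p.Prime] {K : Type*} [NontriviallyNormedField K] [NormedAlgebra ℚ_[p] K]
  [IsUltrametricDist K] [CompleteSpace K] {M : WeierstrassCurve ℤ_[p]} {ℓ : ℚ_[p]⟦X⟧} {i j : ℤ_[p]⟦X⟧}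

/-- **`Λ(c(y)) = ℓ(y)`** for the Honda point `c(y) = ptOf (i(y))`, `‖y‖ < 1`, when `i(0) = 0` and `log_E ∘ (i ⊗ ℚ_p) = ℓ`
(`qEval_subst` for the outer series `log_E`, `‖[Xⁿ]log_E‖ ≤ n`). [cite: Kobayashi2003, §8.4 and Lemma 8.9] -/
theorem ptLog_ptOf_hondaIso [(M.map PadicInt.Coe.ringHom).IsElliptic] (hi0 : constantCoeff i = 0)
    (hlog : (M.map (PadicInt.Coe.ringHom (p := p))).formalLog.subst (i.map PadicInt.Coe.ringHom) = ℓ)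
    {y : unitBall K} (hy : ‖(y : K)‖ < 1) :
    ptLog p K M (ptOf p K M (ev₁ p K y (hasEval_of_norm_lt_one hy) i) (norm_ev₁_lt_one_of_constantCoeff hi0 hy)) =
      qEval p K ℓ (y : K) := by
  rw [ptLog, zCoord_ptOf, bLog, ← hlog]
  exact (qEval_subst (K := K) (norm_coeff_logQ_le (p := p) (M := M)) hi0 hy).symm

/-- `i(j(t)) = t` at points of the open unit ball (`i ∘ j = X`). [folklore] -/
theorem ev₁_hondaIso_ev₁_hondaIsoInv (hj0 : constantCoeff j = 0) (hij : i.subst j = X) {t : unitBall K}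
    (ht : ‖(t : K)‖ < 1) :
    ev₁ p K (ev₁ p K t (hasEval_of_norm_lt_one ht) j)
        (hasEval_of_norm_lt_one (norm_ev₁_lt_one_of_constantCoeff hj0 ht)) i = t := by
  rw [← ev₁_subst hj0 (hasEval_of_norm_lt_one ht), hij, ev₁_X]

variable [hE : (M.map PadicInt.Coe.ringHom).IsElliptic]
  [hint : (curveK p K M).IsIntegral (NormedField.valuation (K := K)).integer]

/-- **Every `P ∈ E₁(K)` is a Honda point**: `P = ptOf (i(y))` with `y = j(z P)`, `‖y‖ ≤ ‖z P‖ < 1` (for a pair with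
`i(0) = j(0) = 0`, `i ∘ j = X`). [cite: Kobayashi2003, §8.4] -/
theorem exists_eq_ptOf_hondaIso (hi0 : constantCoeff i = 0) (hj0 : constantCoeff j = 0) (hij : i.subst j = X)
    {P : (curveK p K M).toAffine.Point} (hP : P ∈ kernel (NormedField.valuation (K := K)) (curveK p K M)) :
    ∃ (y : unitBall K) (hy : ‖(y : K)‖ < 1),
      P = ptOf p K M (ev₁ p K y (hasEval_of_norm_lt_one hy) i) (norm_ev₁_lt_one_of_constantCoeff hi0 hy) ∧
        ‖(y : K)‖ ≤ ‖P.zCoord‖ := by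
  set y : unitBall K := ev₁ p K (zBall P hP) (hasEval_of_norm_lt_one (norm_zBall_lt_one hP)) j with hydef
  have hyle : ‖(y : K)‖ ≤ ‖P.zCoord‖ := norm_ev₁_le _ (norm_zBall_lt_one hP).le hj0
  have hy : ‖(y : K)‖ < 1 := hyle.trans_lt (norm_zCoord_lt_one hP)
  refine ⟨y, hy, ?_, hyle⟩
  refine eq_of_zCoord_eq hP (ptOf_mem_kernel _) ?_
  have hyt : ev₁ p K y (hasEval_of_norm_lt_one hy) i = zBall P hP := ev₁_hondaIso_ev₁_hondaIsoInv hj0 hij (norm_zBall_lt_one hP)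
  rw [zCoord_ptOf, hyt]; rfl

/-- **`Λ(E₁(K)) ⊆ K' + 𝒪_K` from the congruence form of `ℓ`**: if `‖ℓ(y) − μ‖ ≤ 1` has a solution `μ ∈ K'` for every
`‖y‖ < 1`, then every `P ∈ E₁(K)` has `‖Λ(P) − μ‖ ≤ 1` for some `μ ∈ K'` (`Λ(P) = ℓ(y)` for the Honda parameter `y` of `P`).
This is Kobayashi's Prop. 8.11 «`Λ(Ê(𝔪_n)) ⊆ 𝔪_n + k_{n−1}`» once the congruence form of `ℓ` is supplied (file 2).
[cite: Kobayashi2003, Prop. 8.11] -/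
theorem exists_mem_norm_ptLog_sub_le_one_of_forall (hi0 : constantCoeff i = 0)
    (hj0 : constantCoeff j = 0) (hij : i.subst j = X)
    (hlog : (M.map (PadicInt.Coe.ringHom (p := p))).formalLog.subst (i.map PadicInt.Coe.ringHom) = ℓ)
    (K' : Subfield K) (hK' : ∀ y : K, ‖y‖ < 1 → ∃ μ ∈ K', ‖qEval p K ℓ y - μ‖ ≤ 1)
    {P : (curveK p K M).toAffine.Point} (hP : P ∈ kernel (NormedField.valuation (K := K)) (curveK p K M)) :
    ∃ μ ∈ K', ‖ptLog p K M P - μ‖ ≤ 1 := by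
  obtain ⟨y, hy, hPy, -⟩ := exists_eq_ptOf_hondaIso hi0 hj0 hij hP
  rw [hPy, ptLog_ptOf_hondaIso hi0 hlog hy]
  exact hK' _ hy

end Points

end SprungHonda

end Summit.BirchSwinnertonDyer.BirchSwinnertonDyer.Theorems

end
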